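import Summits.ABC.IUTFork.LDHGenuinePerImageSufficiencyPoint
import Literature.IUT.LogVolume.TensorPacketContentShell
import HarnessLib

/-!
# The fork at [IUTchIII] Corollary 3.12, L-DH level, READING (P): the per-image `−|log(Θ)|` realises the different gain AND the
# ECCENTRICITY of the log-shells at every genuine input (abc-iut cell, crux ThetaPartII = stmt-ABC-19678; row «C:PERIMAGE-SHELL», part 1)

Record-only PROOF file (D-0012) of the abc-iut cell (WAVE-3 discharge seat abc-iut-c312-d1, gen 9). TAKES NO SIDE on [IUTchIII]
Cor. 3.12 or on the (U)/(P) readings. Sequel to this seat's `LDHGenuinePerImageSufficiency(Point)` (gen 7, p445807 / p446147).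

There the per-summand lower end of the per-image hull was abc-iut-w6-d018's `−θ_j(v_j) + (d_I(v⃗) − min_J d_{L_J}(v⃗))·log p`. By
abc-iut-w5-d180's orbit formula the hull volume is EXACTLY `−m·log p + H` (`H = Σ_b log‖z_b^max‖`, abc-iut-w5-d082), and by
abc-iut-c312-5's content criterion through the LARGEST INNER BALLS of the factor shells the content `m` is smaller than w6-d018's
bound by `Σ_b log_p(1/ρ_in(b))`; the packet lemma `packetLogμ_packetHull_orbit_ge_shell` (`TensorPacketContentShell`) records the
resulting extra term `Σ_b (log‖z_b‖ − log‖c_b‖) ≥ 0` — the ECCENTRICITY of the factor log-shells `log_p(𝒪^×_{K_{v̲_b}})`, zero at tame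
places (`log_p(𝒪^×) = 𝔪` is a ball) and LARGE at wildly ramified ones (`e ≥ p − 1`: `‖log_p(1+ϖ)‖ = p^{a₀ − p^{a₀}/e}` can exceed `1`).
HERE this is carried to the genuine input:

* `neg_thetaLast_add_dSharp_add_shell_le_logμ_slotImagesHull` — per summand `v⃗`, for largest inner balls `c_b` and nonzero
  `z_b ∈ log_p(𝒪^×_{K_{v̲_b}})`: `−θ_j(v_j) + (d_I − d_{L_J})·log p + Σ_b (log‖z_b‖ − log‖c_b‖) ≤ log μ̄_{v⃗}(hull of the slot images)`;
* **`neg_ndegLgp_add_dSharp_add_shell_le_negLogThetaPerImageNonarch`** — GLOBAL, for any SHELL FUNCTION `S_p(u)` (`u ∈ V(F₀)_p`)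
  dominated at every place by the eccentricity of a shell pair of `K_{u̲}` (hypothesis `hS`):
  `−deĝ̲_lgp(P_Θ) + D♯(I) + Σ_{p∈T(I)} (1/ℓ⋇)·Σ_j Σ_{v⃗} (Σ_b S_p(v_b))·Π Pr ≤ −|log(Θ)|^{nonarch}_(P)`;
* `sum_shell_mul_prod_weight_eq` / `shell_eq_closedForm` — [IUTchIV] Prop. 1.7 averaging: the shell sum is
  `Σ_p ((ℓ⋇+3)/2)·Σ_{u|p} Pr(u)·S_p(u)` (`(1/ℓ⋇)·Σ_{j=1}^{ℓ⋇}(j+1) = (ℓ⋇+3)/2 = (l+5)/4`);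
* **`neg_ndegLgp_add_mul_ndeg_add_shell_le_negLogThetaPerImageNonarch`** (`K/F₀` Galois) and
  **`cor312PerImageOf_of_le_mul_ndeg_add_shell`** — [IUTchIII] Cor. 3.12 IN READING (P) holds at the input as soon as
  `κ_l·deĝ̲(𝔮) ≤ ((ℓ⋇+3)/2 − [F₀:ℚ])·log(𝔡^K) + Σ_{p∈T(I)} ((ℓ⋇+3)/2)·Σ_{u|p} Pr(u)·S_p(u) + ((l+5)/4)·log π`.

At a place with no information `S_p(u) = 0` is always admissible (`exists_shellPair_nonneg`); off the cyclotomic indices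
`S_p(u) = (a − p^a/e + 1/e)·log p` is (`exists_shellPair_ge_of_forall_ne`). The rational-point closed form and the rows are the sequel
`LDHGenuinePerImageShellRat`. Nothing here asserts `Cor312PerImageOf` for any input or the existence of data; (Ind2)/the hull are the
tree's typings of disputed-corpus constructions. [cite: Mochizuki2012, IUTchIII Cor. 3.12 p. 173–174; proof Step (x) p. 181]
[cite: Mochizuki2012, IUTchIV Prop. 1.1 p. 9, Prop. 1.2 (i)(ii) p. 10, Prop. 1.7 p. 16–17, Thm. 1.10 Step (v) p. 27–29, Step (vii) p. 30]
[cite: DupuyHilado2025, Def. 3.6.3, §4.9, §4.12] [claim: Mochizuki2012, status: disputed] for every IUT quotation. PROOF-ONLY: no definitions.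
-/

noncomputable section

open Set Literature.IUT.LogVolume NumberField IsDedekindDomain
open Literature.NumberTheory.GaloisRepresentations.Ultrametric
open scoped Pointwise

namespace Summit.ABC.IUTFork.GenuineContent

section PerImageShell

variable {F₀ : Type} [Field F₀] [NumberField F₀] {K : Type} [Field K] [NumberField K] [Algebra F₀ K]
variable (I : ThetaVolumeInput F₀ K)

/-! ## 1. Per summand: the different AND the shell eccentricity -/

/-- **Per summand of the PER-IMAGE hull**: for largest inner balls `c_b·𝒪 ⊆ log_p(𝒪^×_{K_{v̲_b}})` and nonzero
`z_b ∈ log_p(𝒪^×_{K_{v̲_b}})` on the slots of `v⃗`, and every factor `L_J`: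
`−θ_j(v_j) + (d_I(v⃗) − d_{L_J}(v⃗))·log p + Σ_b (log‖z_b‖ − log‖c_b‖) ≤ log μ̄_{v⃗}(hull of the slot images)` (the slot images are the
(Ind2)-orbit of the last-slot twist `ι_j(t_{Θ,j,v_j})·(R_I)^∼`, abc-iut-s2-p2; then `TensorPacketContentShell.packetLogμ_packetHull_orbit_ge_shell`).
[cite: DupuyHilado2025, §3.9, §4.9, §4.12] [cite: Mochizuki2012, IUTchIV Prop. 1.2 (i)(ii) p. 10] -/
theorem neg_thetaLast_add_dSharp_add_shell_le_logμ_slotImagesHull {p : ℕ} [hp : Fact p.Prime] (i : Fin I.X.lstar)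
    (e : Fin ((i : ℕ) + 1 + 1) → placesOver F₀ p)
    (J : DIdx p (fun b => (I.σ.localFieldFamily p hp.out).k (e b)))
    {c z : ∀ b : Fin ((i : ℕ) + 1 + 1), (I.σ.localFieldFamily p hp.out).k (e b)}
    (hc0 : ∀ b, c b ≠ 0) (hc : ∀ b (o : (I.σ.localFieldFamily p hp.out).k (e b)), ‖o‖ ≤ 1 → c b * o ∈ logUnits _)
    (hmax : ∀ b, ∃ (ϖ : ((I.σ.localFieldFamily p hp.out).k (e b))ˣ) (w : (I.σ.localFieldFamily p hp.out).k (e b)),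
      IsUniformizer ϖ ∧ w ∉ logUnits _ ∧ ‖w‖ * ‖(ϖ : (I.σ.localFieldFamily p hp.out).k (e b))‖ ≤ ‖c b‖)
    (hz0 : ∀ b, z b ≠ 0) (hzΛ : ∀ b, z b ∈ logUnits _) :
    -(I.X.thetaPilot i (e (Fin.last _)).1 * logNorm F₀ (e (Fin.last _)).1 / localDegree F₀ (e (Fin.last _)).1)
        + (dSum p (fun b => (I.σ.localFieldFamily p hp.out).k (e b))
            - differentOrd p (DFac p (fun b => (I.σ.localFieldFamily p hp.out).k (e b)) J)) * Real.log p
        + ∑ b, (Real.log ‖z b‖ - Real.log ‖c b‖) ≤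
      (realPrimePacketM p (I.σ.localFieldFamily p hp.out)).logμ
        ((realPrimePacketM p (I.σ.localFieldFamily p hp.out)).slotImagesHull
          ((realPrimePacketM p (I.σ.localFieldFamily p hp.out)).pilotRegion (I.tΘ p hp.out))
            ((i : ℕ) + 1) e) := by
  have hw := packetLogμ_packetHull_orbit_ge_shell p (fun b => (I.σ.localFieldFamily p hp.out).k (e b))
    hc0 hc hmax hz0 hzΛ
    (isPsiBounded_smul_normalizedPacket p (fun b => (I.σ.localFieldFamily p hp.out).k (e b))
      (iota p (fun b => (I.σ.localFieldFamily p hp.out).k (e b)) (Fin.last _)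
        (I.tΘ p hp.out i (e (Fin.last _)) : (I.σ.localFieldFamily p hp.out).k (e (Fin.last _)))))
    (I.tΘ p hp.out i (e (Fin.last _))).ne_zero subset_rfl J
  have heq : (realPrimePacketM p (I.σ.localFieldFamily p hp.out)).slotImagesHull
        ((realPrimePacketM p (I.σ.localFieldFamily p hp.out)).pilotRegion (I.tΘ p hp.out)) ((i : ℕ) + 1) e =
      packetHull p (fun b => (I.σ.localFieldFamily p hp.out).k (e b))
        (⋃ γ : indTwo p (fun b => (I.σ.localFieldFamily p hp.out).k (e b)),
          γ • (iota p (fun b => (I.σ.localFieldFamily p hp.out).k (e b)) (Fin.last _)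
            (I.tΘ p hp.out i (e (Fin.last _)) : (I.σ.localFieldFamily p hp.out).k (e (Fin.last _))) •
            (normalizedPacket p (fun b => (I.σ.localFieldFamily p hp.out).k (e b)) :
              Set (PacketAlgebra p (fun b => (I.σ.localFieldFamily p hp.out).k (e b)))))) := by
    show packetHull p (fun b => (I.σ.localFieldFamily p hp.out).k (e b))
        ((realPrimePacketWith p (I.σ.localFieldFamily p hp.out) (mScale p _) (mScale_ne_zero p _) (mScale_perm p _)).slotImages
          ((realPrimePacketWith p (I.σ.localFieldFamily p hp.out) (mScale p _) (mScale_ne_zero p _)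
            (mScale_perm p _)).pilotRegion (I.tΘ p hp.out)) ((i : ℕ) + 1) e) = _
    rw [realPrimePacketWith_slotImages_pilotRegion_eq]
  show _ ≤ packetLogμ p (fun b => (I.σ.localFieldFamily p hp.out).k (e b))
    ((realPrimePacketM p (I.σ.localFieldFamily p hp.out)).slotImagesHull
      ((realPrimePacketM p (I.σ.localFieldFamily p hp.out)).pilotRegion (I.tΘ p hp.out)) ((i : ℕ) + 1) e)
  rw [heq, ← log_norm_tΘ I i (e (Fin.last _))]
  exact hw

/-! ## 2. Global: the shell function -/

/-- **GLOBAL LOWER END IN READING (P) WITH A SHELL FUNCTION.** For any `S_p(u) ∈ ℝ` (`p` prime, `u ∈ V(F₀)_p`) such that every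
completion `K_{u̲}` carries a shell pair — a largest inner ball `c·𝒪 ⊆ log_p(𝒪^×)` (with maximality witness) and a nonzero
`z ∈ log_p(𝒪^×)` — with `S_p(u) ≤ log‖z‖ − log‖c‖` (hypothesis `hS`):
`−ndegLgpOn(P_Θ; T(I)) + Σ_{p∈T(I)} (1/ℓ⋇)·Σ_j Σ_{v⃗} ((d_I(v⃗) − min_J d_{L_J}(v⃗))·log p + Σ_b S_p(v_b))·Π_b Pr(v_b) ≤ negLogThetaPerImageNonarch I`.
[cite: DupuyHilado2025, Def. 3.6.3, §4.12] [cite: Mochizuki2012, IUTchIII Cor. 3.12 proof Step (x) p. 181; IUTchIV Prop. 1.1 p. 9, Prop. 1.2 p. 10] -/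
theorem neg_ndegLgpOn_add_dSharp_add_shell_le_negLogThetaPerImageNonarch (S : (p : ℕ) → placesOver F₀ p → ℝ)
    (hS : ∀ (p : ℕ) [hp : Fact p.Prime] (u : placesOver F₀ p), ∃ c z : (I.σ.localFieldFamily p hp.out).k u,
      c ≠ 0 ∧ (∀ o : (I.σ.localFieldFamily p hp.out).k u, ‖o‖ ≤ 1 → c * o ∈ logUnits _) ∧
      (∃ (ϖ : ((I.σ.localFieldFamily p hp.out).k u)ˣ) (w : (I.σ.localFieldFamily p hp.out).k u),
        IsUniformizer ϖ ∧ w ∉ logUnits _ ∧ ‖w‖ * ‖(ϖ : (I.σ.localFieldFamily p hp.out).k u)‖ ≤ ‖c‖) ∧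
      z ≠ 0 ∧ z ∈ logUnits _ ∧ S p u ≤ Real.log ‖z‖ - Real.log ‖c‖) :
    -I.X.ndegLgpOn I.supportPrimes
        + ∑ p ∈ I.supportPrimes, (1 / (I.X.lstar : ℝ)) * ∑ i : Fin I.X.lstar,
            ∑ e : Fin ((i : ℕ) + 1 + 1) → placesOver F₀ p,
              (if hp : p.Prime then
                haveI : Fact p.Prime := ⟨hp⟩
                (dSum p (fun b => (I.σ.localFieldFamily p hp).k (e b))
                  - (Finset.univ : Finset (DIdx p (fun b => (I.σ.localFieldFamily p hp).k (e b)))).inf'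
                      Finset.univ_nonempty
                      (fun J => differentOrd p (DFac p (fun b => (I.σ.localFieldFamily p hp).k (e b)) J)))
                  * Real.log p + ∑ b, S p (e b)
               else 0) * ∏ b, weight F₀ (e b).1 ≤
      I.negLogThetaPerImageNonarch := by
  unfold ThetaVolumeInput.negLogThetaPerImageNonarch PilotData.ndegLgpOn
  rw [← Finset.sum_neg_distrib, ← Finset.sum_add_distrib]
  refine Finset.sum_le_sum fun p hpT => ?_
  have hp' : p.Prime := I.prime_of_mem_supportPrimes hpT
  haveI hp : Fact p.Prime := ⟨hp'⟩
  simp only [dif_pos hp']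
  rw [negLogThetaPerImageLoc_eq_sum, ← mul_neg, ← mul_add, ← Finset.sum_neg_distrib, ← Finset.sum_add_distrib]
  refine mul_le_mul_of_nonneg_left (Finset.sum_le_sum fun i _ => ?_) (one_div_lstar_nonneg I)
  rw [← Finset.sum_neg_distrib, ← Finset.sum_add_distrib]
  refine Finset.sum_le_sum fun e _ => ?_
  rw [← neg_mul, ← add_mul]
  refine mul_le_mul_of_nonneg_right ?_ (prod_weight_nonneg e)
  simp only [PilotData.slotValue]
  -- choose the shell pairs on the slots and the least factor different
  have hS' := fun b => hS p (e b)
  choose c z hc0 hc hmax hz0 hzΛ hle using hS'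
  obtain ⟨J₀, -, hJ₀⟩ := Finset.exists_mem_eq_inf' (Finset.univ_nonempty : (Finset.univ :
    Finset (DIdx p (fun b => (I.σ.localFieldFamily p hp.out).k (e b)))).Nonempty)
    (fun J => differentOrd p (DFac p (fun b => (I.σ.localFieldFamily p hp.out).k (e b)) J))
  have hsum : ∑ b, S p (e b) ≤ ∑ b, (Real.log ‖z b‖ - Real.log ‖c b‖) := Finset.sum_le_sum fun b _ => hle b
  have hmain := neg_thetaLast_add_dSharp_add_shell_le_logμ_slotImagesHull I i e J₀ hc0 hc hmax hz0 hzΛ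
  rw [hJ₀]
  linarith

/-- **`−deĝ̲_lgp(P_Θ) + D♯(I) + shell ≤ −|log(Θ)|^{nonarch}_(P)`** — the same with the last-slot aggregate identified with
`deĝ̲_lgp(P_Θ)` (Dupuy–Hilado Thm. 3.10.1, abc-iut-S8's `DHData.ndegLgpOn_eq_ndegLgp`). [cite: DupuyHilado2025, Thm. 3.10.1, §4.12]
[cite: Mochizuki2012, IUTchIII Cor. 3.12 proof Step (x) p. 181] -/
theorem neg_ndegLgp_add_dSharp_add_shell_le_negLogThetaPerImageNonarch (S : (p : ℕ) → placesOver F₀ p → ℝ)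
    (hS : ∀ (p : ℕ) [hp : Fact p.Prime] (u : placesOver F₀ p), ∃ c z : (I.σ.localFieldFamily p hp.out).k u,
      c ≠ 0 ∧ (∀ o : (I.σ.localFieldFamily p hp.out).k u, ‖o‖ ≤ 1 → c * o ∈ logUnits _) ∧
      (∃ (ϖ : ((I.σ.localFieldFamily p hp.out).k u)ˣ) (w : (I.σ.localFieldFamily p hp.out).k u),
        IsUniformizer ϖ ∧ w ∉ logUnits _ ∧ ‖w‖ * ‖(ϖ : (I.σ.localFieldFamily p hp.out).k u)‖ ≤ ‖c‖) ∧
      z ≠ 0 ∧ z ∈ logUnits _ ∧ S p u ≤ Real.log ‖z‖ - Real.log ‖c‖) :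
    -LgpDivisor.ndegLgp I.X.thetaPilot
        + ∑ p ∈ I.supportPrimes, (1 / (I.X.lstar : ℝ)) * ∑ i : Fin I.X.lstar,
            ∑ e : Fin ((i : ℕ) + 1 + 1) → placesOver F₀ p,
              (if hp : p.Prime then
                haveI : Fact p.Prime := ⟨hp⟩
                (dSum p (fun b => (I.σ.localFieldFamily p hp).k (e b))
                  - (Finset.univ : Finset (DIdx p (fun b => (I.σ.localFieldFamily p hp).k (e b)))).inf'
                      Finset.univ_nonempty
                      (fun J => differentOrd p (DFac p (fun b => (I.σ.localFieldFamily p hp).k (e b)) J)))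
                  * Real.log p + ∑ b, S p (e b)
               else 0) * ∏ b, weight F₀ (e b).1 ≤
      I.negLogThetaPerImageNonarch := by
  have h2 : I.X.ndegLgpOn I.supportPrimes = LgpDivisor.ndegLgp I.X.thetaPilot :=
    (DHData.ofInput I).ndegLgpOn_eq_ndegLgp
  rw [← h2]
  exact neg_ndegLgpOn_add_dSharp_add_shell_le_negLogThetaPerImageNonarch I S hS

/-! ## 3. [IUTchIV] Prop. 1.7 averaging of the shell function -/

/-- `Σ_{i<n} (i+2) = n(n+3)/2`. [folklore] -/
private theorem sum_fin_add_two' (n : ℕ) : ∑ i : Fin n, ((i : ℕ) + 2 : ℝ) = (n : ℝ) * ((n : ℝ) + 3) / 2 := by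
  induction n with
  | zero => simp
  | succ n ih =>
    rw [Fin.sum_univ_castSucc]
    simp only [Fin.val_castSucc, Fin.val_last]
    rw [ih]
    push_cast
    ring

/-- **Prop. 1.7 at a prime, for the shell function**: for every degree `j = i+1`,
`Σ_{v⃗ ∈ V(F₀)_p^{j+1}} (Σ_b S_p(v_b))·Π_b Pr(v_b) = (j+1)·Σ_u Pr(u)·S_p(u)` (the tree's
`WeightedAverage.mul_betaTotal_mul_lamTotal_pow` with `β = S_p`, `λ = Pr`, `Σ Pr = 1`). [cite: Mochizuki2012, IUTchIV Prop. 1.7 p. 16–17] -/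
theorem sum_shell_mul_prod_weight_eq {p : ℕ} [hp : Fact p.Prime] (S : placesOver F₀ p → ℝ) (i : Fin I.X.lstar) :
    ∑ e : Fin ((i : ℕ) + 1 + 1) → placesOver F₀ p, (∑ b, S (e b)) * ∏ b, weight F₀ (e b).1 =
      (((i : ℕ) + 2 : ℝ)) * ∑ u : placesOver F₀ p, weight F₀ u.1 * S u := by
  classical
  set w : placesOver F₀ p → ℝ := fun u => weight F₀ u.1 with hw
  have h17 := Literature.Algebra.PolynomialIdentities.WeightedAverage.mul_betaTotal_mul_lamTotal_pow S w ((i : ℕ) + 1)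
  have hlam : Literature.Algebra.PolynomialIdentities.WeightedAverage.lamTotal w = 1 := (localWeights F₀ p).sum_pr
  rw [hlam, one_pow, mul_one] at h17
  have hbt : Literature.Algebra.PolynomialIdentities.WeightedAverage.betaTotal S w =
      ∑ u : placesOver F₀ p, weight F₀ u.1 * S u := by
    simp only [Literature.Algebra.PolynomialIdentities.WeightedAverage.betaTotal, hw]
    exact Finset.sum_congr rfl fun u _ => mul_comm _ _
  have hsplit : ∀ e : Fin ((i : ℕ) + 1 + 1) → placesOver F₀ p,
      (∑ b, S (e b)) * ∏ b, weight F₀ (e b).1 =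
        Literature.Algebra.PolynomialIdentities.WeightedAverage.tupleBeta S e *
          Literature.Algebra.PolynomialIdentities.WeightedAverage.tupleLam w e := by
    intro e
    simp only [Literature.Algebra.PolynomialIdentities.WeightedAverage.tupleBeta,
      Literature.Algebra.PolynomialIdentities.WeightedAverage.tupleLam, hw]
  rw [Finset.sum_congr rfl fun e _ => hsplit e, ← h17, hbt]
  push_cast
  ring

/-- **THE CLOSED FORM OF THE SHELL SUM**: `Σ_{p∈T(I)} (1/ℓ⋇)·Σ_j Σ_{v⃗} (Σ_b S_p(v_b))·Π Pr = Σ_{p∈T(I)} ((ℓ⋇+3)/2)·Σ_{u|p} Pr(u)·S_p(u)`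
(`(1/ℓ⋇)·Σ_{j=1}^{ℓ⋇}(j+1) = (ℓ⋇+3)/2 = (l+5)/4`, [IUTchIV] (E1)). [cite: Mochizuki2012, IUTchIV Thm. 1.10 Step (i) (E1) p. 23, Prop. 1.7 p. 16–17] -/
theorem shell_eq_closedForm (S : (p : ℕ) → placesOver F₀ p → ℝ) :
    ∑ p ∈ I.supportPrimes, (1 / (I.X.lstar : ℝ)) * ∑ i : Fin I.X.lstar,
        ∑ e : Fin ((i : ℕ) + 1 + 1) → placesOver F₀ p, (∑ b, S p (e b)) * ∏ b, weight F₀ (e b).1 =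
      ∑ p ∈ I.supportPrimes, (((I.X.lstar : ℝ) + 3) / 2) * ∑ u : placesOver F₀ p, weight F₀ u.1 * S p u := by
  refine Finset.sum_congr rfl fun p hpT => ?_
  have hp' : p.Prime := I.prime_of_mem_supportPrimes hpT
  haveI hp : Fact p.Prime := ⟨hp'⟩
  have hl0 : (I.X.lstar : ℝ) ≠ 0 := by
    have := I.X.two_le_lstar
    exact_mod_cast (by omega : I.X.lstar ≠ 0)
  set B : ℝ := ∑ u : placesOver F₀ p, weight F₀ u.1 * S p u with hB
  rw [Finset.sum_congr rfl fun i _ => sum_shell_mul_prod_weight_eq I (S p) i]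
  rw [Finset.sum_congr rfl fun (i : Fin I.X.lstar) _ => (mul_comm (((i : ℕ) + 2 : ℝ)) B), ← Finset.mul_sum,
    sum_fin_add_two']
  field_simp

/-- **`−deĝ̲_lgp(P_Θ) + CLOSED FORM + SHELL CLOSED FORM ≤ −|log(Θ)|^{nonarch}_(P)`**:
`−deĝ̲_lgp(P_Θ) + Σ_{p∈T(I)} (((ℓ⋇+3)/2)·Σ_u Pr(u)·d(K_{u̲}) − Σ_u d(K_{u̲}))·log p + Σ_{p∈T(I)} ((ℓ⋇+3)/2)·Σ_u Pr(u)·S_p(u) ≤ −|log(Θ)|^{nonarch}_(P)`.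
[cite: Mochizuki2012, IUTchIV Thm. 1.10 Step (v) p. 27–29] [cite: DupuyHilado2025, §4.12] -/
theorem neg_ndegLgp_add_closedForm_add_shell_le_negLogThetaPerImageNonarch (S : (p : ℕ) → placesOver F₀ p → ℝ)
    (hS : ∀ (p : ℕ) [hp : Fact p.Prime] (u : placesOver F₀ p), ∃ c z : (I.σ.localFieldFamily p hp.out).k u,
      c ≠ 0 ∧ (∀ o : (I.σ.localFieldFamily p hp.out).k u, ‖o‖ ≤ 1 → c * o ∈ logUnits _) ∧
      (∃ (ϖ : ((I.σ.localFieldFamily p hp.out).k u)ˣ) (w : (I.σ.localFieldFamily p hp.out).k u),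
        IsUniformizer ϖ ∧ w ∉ logUnits _ ∧ ‖w‖ * ‖(ϖ : (I.σ.localFieldFamily p hp.out).k u)‖ ≤ ‖c‖) ∧
      z ≠ 0 ∧ z ∈ logUnits _ ∧ S p u ≤ Real.log ‖z‖ - Real.log ‖c‖) :
    -LgpDivisor.ndegLgp I.X.thetaPilot
        + ∑ p ∈ I.supportPrimes,
            (if hp : p.Prime then
              haveI : Fact p.Prime := ⟨hp⟩
              ((((I.X.lstar : ℝ) + 3) / 2) *
                  ∑ u : placesOver F₀ p, weight F₀ u.1 * differentOrd p ((I.σ.localFieldFamily p hp).k u)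
                - dSum p (fun u : placesOver F₀ p => (I.σ.localFieldFamily p hp).k u)) * Real.log p
             else 0)
        + ∑ p ∈ I.supportPrimes, (((I.X.lstar : ℝ) + 3) / 2) * ∑ u : placesOver F₀ p, weight F₀ u.1 * S p u ≤
      I.negLogThetaPerImageNonarch := by
  have hmain := neg_ndegLgp_add_dSharp_add_shell_le_negLogThetaPerImageNonarch I S hS
  rw [← dExplicit_eq_closedForm I, ← shell_eq_closedForm I S]
  -- split the combined sum and compare the different part termwise (`min_J d_{L_J} ≤ Σ_u d(K_u)`)
  have hsplit : ∑ p ∈ I.supportPrimes, (1 / (I.X.lstar : ℝ)) * ∑ i : Fin I.X.lstar,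
        ∑ e : Fin ((i : ℕ) + 1 + 1) → placesOver F₀ p,
          (if hp : p.Prime then
            haveI : Fact p.Prime := ⟨hp⟩
            (dSum p (fun b => (I.σ.localFieldFamily p hp).k (e b))
              - (Finset.univ : Finset (DIdx p (fun b => (I.σ.localFieldFamily p hp).k (e b)))).inf'
                  Finset.univ_nonempty
                  (fun J => differentOrd p (DFac p (fun b => (I.σ.localFieldFamily p hp).k (e b)) J)))
              * Real.log p + ∑ b, S p (e b)
           else 0) * ∏ b, weight F₀ (e b).1 =
      (∑ p ∈ I.supportPrimes, (1 / (I.X.lstar : ℝ)) * ∑ i : Fin I.X.lstar,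
        ∑ e : Fin ((i : ℕ) + 1 + 1) → placesOver F₀ p,
          (if hp : p.Prime then
            haveI : Fact p.Prime := ⟨hp⟩
            (dSum p (fun b => (I.σ.localFieldFamily p hp).k (e b))
              - (Finset.univ : Finset (DIdx p (fun b => (I.σ.localFieldFamily p hp).k (e b)))).inf'
                  Finset.univ_nonempty
                  (fun J => differentOrd p (DFac p (fun b => (I.σ.localFieldFamily p hp).k (e b)) J)))
              * Real.log p
           else 0) * ∏ b, weight F₀ (e b).1)
        + ∑ p ∈ I.supportPrimes, (1 / (I.X.lstar : ℝ)) * ∑ i : Fin I.X.lstar,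
            ∑ e : Fin ((i : ℕ) + 1 + 1) → placesOver F₀ p, (∑ b, S p (e b)) * ∏ b, weight F₀ (e b).1 := by
    rw [← Finset.sum_add_distrib]
    refine Finset.sum_congr rfl fun p hpT => ?_
    have hp' : p.Prime := I.prime_of_mem_supportPrimes hpT
    simp only [dif_pos hp']
    rw [← mul_add, ← Finset.sum_add_distrib]
    congr 1
    refine Finset.sum_congr rfl fun i _ => ?_
    rw [← Finset.sum_add_distrib]
    refine Finset.sum_congr rfl fun e _ => ?_
    ring
  rw [hsplit] at hmain
  have hdiff := neg_ndegLgp_add_dExplicit_le_negLogThetaPerImageNonarch I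
  -- the explicit different part is below the sharp one, termwise (abc-iut-S4's `dExplicitTerm_le_dSharpTerm`)
  have hle : ∑ p ∈ I.supportPrimes, (1 / (I.X.lstar : ℝ)) * ∑ i : Fin I.X.lstar,
        ∑ e : Fin ((i : ℕ) + 1 + 1) → placesOver F₀ p,
          (if hp : p.Prime then
            haveI : Fact p.Prime := ⟨hp⟩
            (dSum p (fun b => (I.σ.localFieldFamily p hp).k (e b))
              - dSum p (fun u : placesOver F₀ p => (I.σ.localFieldFamily p hp).k u)) * Real.log p
           else 0) * ∏ b, weight F₀ (e b).1 ≤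
      ∑ p ∈ I.supportPrimes, (1 / (I.X.lstar : ℝ)) * ∑ i : Fin I.X.lstar,
        ∑ e : Fin ((i : ℕ) + 1 + 1) → placesOver F₀ p,
          (if hp : p.Prime then
            haveI : Fact p.Prime := ⟨hp⟩
            (dSum p (fun b => (I.σ.localFieldFamily p hp).k (e b))
              - (Finset.univ : Finset (DIdx p (fun b => (I.σ.localFieldFamily p hp).k (e b)))).inf'
                  Finset.univ_nonempty
                  (fun J => differentOrd p (DFac p (fun b => (I.σ.localFieldFamily p hp).k (e b)) J)))
              * Real.log p
           else 0) * ∏ b, weight F₀ (e b).1 := by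
    refine Finset.sum_le_sum fun p hpT => ?_
    have hp' : p.Prime := I.prime_of_mem_supportPrimes hpT
    haveI hp : Fact p.Prime := ⟨hp'⟩
    refine mul_le_mul_of_nonneg_left (Finset.sum_le_sum fun i _ => Finset.sum_le_sum fun e _ => ?_)
      (one_div_lstar_nonneg I)
    refine mul_le_mul_of_nonneg_right ?_ (prod_weight_nonneg e)
    simp only [dif_pos hp']
    exact mul_le_mul_of_nonneg_right (dExplicitTerm_le_dSharpTerm I i e)
      (Real.log_nonneg (by exact_mod_cast hp'.one_lt.le))
  linarith

/-! ## 4. `K/F₀` Galois: the log-different of `K` and the (P)-line sufficiency with the shell term -/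

/-- **Input level, `K/F₀` Galois: `−deĝ̲_lgp(P_Θ) + ((ℓ⋇+3)/2 − [F₀:ℚ])·log(𝔡^K) + Σ_{p∈T(I)} ((ℓ⋇+3)/2)·Σ_{u|p} Pr(u)·S_p(u) ≤
−|log(Θ)|^{nonarch}_(P)`** (abc-iut-S4's `dExplicit_closedForm_ge` and `sum_supportPrimes_weight_mul_differentOrd_eq_ndeg`).
[cite: Mochizuki2012, IUTchIV Thm. 1.10 Step (v) p. 27–29] [cite: DupuyHilado2025, §4.12] -/
theorem neg_ndegLgp_add_mul_ndeg_add_shell_le_negLogThetaPerImageNonarch [IsGalois F₀ K]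
    (S : (p : ℕ) → placesOver F₀ p → ℝ)
    (hS : ∀ (p : ℕ) [hp : Fact p.Prime] (u : placesOver F₀ p), ∃ c z : (I.σ.localFieldFamily p hp.out).k u,
      c ≠ 0 ∧ (∀ o : (I.σ.localFieldFamily p hp.out).k u, ‖o‖ ≤ 1 → c * o ∈ logUnits _) ∧
      (∃ (ϖ : ((I.σ.localFieldFamily p hp.out).k u)ˣ) (w : (I.σ.localFieldFamily p hp.out).k u),
        IsUniformizer ϖ ∧ w ∉ logUnits _ ∧ ‖w‖ * ‖(ϖ : (I.σ.localFieldFamily p hp.out).k u)‖ ≤ ‖c‖) ∧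
      z ≠ 0 ∧ z ∈ logUnits _ ∧ S p u ≤ Real.log ‖z‖ - Real.log ‖c‖) :
    -LgpDivisor.ndegLgp I.X.thetaPilot
        + (((I.X.lstar : ℝ) + 3) / 2 - Module.finrank ℚ F₀) * ndeg K (differentDivisor K)
        + ∑ p ∈ I.supportPrimes, (((I.X.lstar : ℝ) + 3) / 2) * ∑ u : placesOver F₀ p, weight F₀ u.1 * S p u ≤
      I.negLogThetaPerImageNonarch := by
  have h1 := neg_ndegLgp_add_closedForm_add_shell_le_negLogThetaPerImageNonarch I S hS
  have h2 := dExplicit_closedForm_ge I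
  rw [sum_supportPrimes_weight_mul_differentOrd_eq_ndeg I] at h2
  linarith

/-- **[IUTchIII] COR. 3.12 IN READING (P) holds at a genuine input with `K/F₀` Galois whenever
`((l+1)/24 − 1/(2l))·deĝ̲(𝔮) ≤ ((ℓ⋇+3)/2 − [F₀:ℚ])·log(𝔡^K) + Σ_{p∈T(I)} ((ℓ⋇+3)/2)·Σ_{u|p} Pr(u)·S_p(u) + ((l+5)/4)·log π`**
for a shell function `S` dominated by the eccentricity of a shell pair at every place. No side taken on the claim for ALL data.
[cite: Mochizuki2012, IUTchIII Cor. 3.12 p. 173–174; proof Step (x) p. 181] [cite: Mochizuki2012, IUTchIV Thm. 1.10 Step (vii) p. 30] -/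
theorem cor312PerImageOf_of_le_mul_ndeg_add_shell [IsGalois F₀ K] (S : (p : ℕ) → placesOver F₀ p → ℝ)
    (hS : ∀ (p : ℕ) [hp : Fact p.Prime] (u : placesOver F₀ p), ∃ c z : (I.σ.localFieldFamily p hp.out).k u,
      c ≠ 0 ∧ (∀ o : (I.σ.localFieldFamily p hp.out).k u, ‖o‖ ≤ 1 → c * o ∈ logUnits _) ∧
      (∃ (ϖ : ((I.σ.localFieldFamily p hp.out).k u)ˣ) (w : (I.σ.localFieldFamily p hp.out).k u),
        IsUniformizer ϖ ∧ w ∉ logUnits _ ∧ ‖w‖ * ‖(ϖ : (I.σ.localFieldFamily p hp.out).k u)‖ ≤ ‖c‖) ∧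
      z ≠ 0 ∧ z ∈ logUnits _ ∧ S p u ≤ Real.log ‖z‖ - Real.log ‖c‖)
    (h : (((I.X.l : ℝ) + 1) / 24 - 1 / (2 * (I.X.l : ℝ))) * FinDivisor.ndeg F₀ I.X.qDivisor ≤
      (((I.X.lstar : ℝ) + 3) / 2 - Module.finrank ℚ F₀) * ndeg K (differentDivisor K)
        + ∑ p ∈ I.supportPrimes, (((I.X.lstar : ℝ) + 3) / 2) * ∑ u : placesOver F₀ p, weight F₀ u.1 * S p u
        + ThetaVolumeInput.archLogTheta I.l) :
    I.Cor312PerImageOf := by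
  have hlow := neg_ndegLgp_add_mul_ndeg_add_shell_le_negLogThetaPerImageNonarch I S hS
  rw [DHData.ndegLgp_thetaPilot_eq] at hlow
  have hq := I.negAbsLogQ_eq
  unfold ThetaVolumeInput.Cor312PerImageOf ThetaVolumeInput.negLogThetaPerImage
  rw [hq]
  have hsplit : (((I.X.l : ℝ) + 1) / 24 - 1 / (2 * (I.X.l : ℝ))) * FinDivisor.ndeg F₀ I.X.qDivisor =
      ((I.X.l : ℝ) + 1) / 24 * FinDivisor.ndeg F₀ I.X.qDivisor
        - 1 / (2 * (I.X.l : ℝ)) * FinDivisor.ndeg F₀ I.X.qDivisor := sub_mul _ _ _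
  change -(1 / (2 * (I.X.l : ℝ))) * FinDivisor.ndeg F₀ I.X.qDivisor ≤
    I.negLogThetaPerImageNonarch + ThetaVolumeInput.archLogTheta I.X.l
  change _ ≤ _ + ThetaVolumeInput.archLogTheta I.X.l at h
  linarith

end PerImageShell

end Summit.ABC.IUTFork.GenuineContent

end
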